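import Literature.NumberTheory.PAdicHodge.TateInvariantsBase
import HarnessLib

/-!
# `H¹` of a finite layer: a cocycle of `G₀ = Gal(F̄/ℚ_p)` trivial on `Gal(F̄/L)`, `[L : ℚ_p] < ∞`,
# is a coboundary (averaging over coset representatives)

Topic `Literature/NumberTheory/PAdicHodge`; companion of `TateTwistInvariants` (norm transfer) and
`TateLogCyclotomicClass` (trace transfer). Notation: `K₀ = PadicBase F p hp ≅ ℚ_p`, `F̄ = NormedAlgClosure F`,
`ℂ_F = CompletedAlgClosure F`, `G₀ = BaseGaloisGroup hp`. THEOREMS ONLY; no named fact, no `sorry`.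

For a finite subextension `L` of `F̄/K₀` (an `IntermediateField` with `FiniteDimensional K₀ L`) and a
`1`-cocycle `f : G₀ → ℂ_F` (`f(gh) = f(g) + g • f(h)`) that VANISHES on `Gal(F̄/L) = L.fixingSubgroup`, there is
`c ∈ ℂ_F` with `f(g) = g • c − c` for all `g ∈ G₀` (`exists_eq_smul_sub_of_forall_fixingSubgroup`): `f` is
inflated from the finite `G₀`-set `G₀ / Gal(F̄/L)` of `K₀`-embeddings `L → F̄`, and `c = −d⁻¹ Σ_φ f(s_φ)` over
coset representatives `s_φ` (built inside the proof with `AlgHom.liftNormal`, as in the tree's `TateDescent`) (`d = #(L →ₐ[K₀] F̄)`, invertible in characteristic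
`0`) — the averaging proof of "`H^q(G, M)` is killed by `|G|`" in degree `1` with `ℚ`-divisible
coefficients. This is the finite-layer step of Tate's computation `H¹(Gal(F̄/ℚ_p), ℂ_F) = ℚ_p · log χ`
(Tate 1967 §3.3 Thm. 1), complementing the tree's `TateTraceKernel` (`H¹` criterion on `\widehat{K_∞}`) and
`TateLogCyclotomicClass`.

## References
* J. W. S. Cassels, A. Fröhlich (eds.), *Algebraic Number Theory* (1967), Ch. IV (Atiyah–Wall) §6,
  Cor. 1 to Prop. 8 (`|G|` kills `H^q(G, M)`, `q ≥ 1`). [CasselsFrohlichANT1967]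
* J.-P. Serre, *Local Fields*, Ch. VIII §2 Cor. 1; Ch. X §1 Prop. 1 (additive Hilbert 90). [SerreLocalFields1979]
* J. Tate, *p-divisible groups* (1967), §3.3 (proof of Theorem 1). [Tate1967]
-/

noncomputable section

open ValuativeRel Field UniformSpace Finset

open scoped IntermediateField

namespace Literature.NumberTheory.PAdicHodge

open Literature.NumberTheory.GaloisRepresentations
open Literature.NumberTheory.GaloisRepresentations.IsNonarchimedeanLocalField

variable {F : Type} [Field F] [ValuativeRel F] [TopologicalSpace F] [IsNonarchimedeanLocalField F]
  [CharZero F] {p : ℕ} [Fact p.Prime] (hp : valuation F p < 1)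

namespace FiniteLayer

/-- `G₀` fixes natural-number scalars in `ℂ_F`. [folklore] -/
private theorem smul_natCast (g : BaseGaloisGroup hp) (d : ℕ) : g • (d : CompletedAlgClosure F) = d :=
  map_natCast (MulSemiringAction.toRingHom (BaseGaloisGroup hp) (CompletedAlgClosure F) g) d

/-- **A `1`-cocycle of `G₀` with values in `ℂ_F`, trivial on `Gal(F̄/L)` for a FINITE layer `L/K₀`, is a
coboundary**: for an intermediate field `L` of `F̄/K₀` with `[L : K₀] < ∞`, if `f(gh) = f(g) + g • f(h)` for
all `g, h ∈ G₀` and `f(h) = 0` for all `h` fixing `L` pointwise, then `f(g) = g • c − c` for some `c ∈ ℂ_F` —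
namely `c = −d⁻¹ Σ_φ f(s_φ)` over extensions `s_φ ∈ G₀` of the `d` embeddings `φ : L → F̄` over `K₀`
(coset representatives of `Gal(F̄/L)`; `g s_φ = s_{gφ} h_φ` with `h_φ` fixing `L`). Degree-`1` case of
"`|G|` kills `H^q(G, M)`" for the finite `G₀`-set `G₀/Gal(F̄/L)` and uniquely divisible coefficients.
[cite: CasselsFrohlichANT1967, Ch. IV §6 Cor. 1 to Prop. 8] [cite: SerreLocalFields1979, Ch. VIII §2 Cor. 1] -/
theorem exists_eq_smul_sub_of_forall_fixingSubgroup
    (L : IntermediateField (PadicBase F p hp) (NormedAlgClosure F)) [FiniteDimensional (PadicBase F p hp) L]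
    (f : BaseGaloisGroup hp → CompletedAlgClosure F)
    (hcoc : ∀ g h : BaseGaloisGroup hp, f (g * h) = f g + g • f h)
    (hvan : ∀ h : BaseGaloisGroup hp, h ∈ L.fixingSubgroup → f h = 0) :
    ∃ c : CompletedAlgClosure F, ∀ g : BaseGaloisGroup hp, f g = g • c - c := by
  classical
  haveI : CharZero (CompletedAlgClosure F) :=
    charZero_of_injective_algebraMap (algebraMap F (CompletedAlgClosure F)).injective
  -- the finite set of `K₀`-embeddings `L → F̄` and their extensions `s_φ ∈ G₀`
  letI : Fintype (L →ₐ[PadicBase F p hp] NormedAlgClosure F) :=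
    minpoly.AlgHom.fintype (PadicBase F p hp) L (NormedAlgClosure F)
  let s : (L →ₐ[PadicBase F p hp] NormedAlgClosure F) → BaseGaloisGroup hp := fun φ =>
    AlgEquiv.ofBijective (φ.liftNormal (NormedAlgClosure F)) (Algebra.IsAlgebraic.algHom_bijective _)
  have hs : ∀ (φ : L →ₐ[PadicBase F p hp] NormedAlgClosure F) (x : L), s φ (x : NormedAlgClosure F) = φ x := by
    intro φ x
    change φ.liftNormal (NormedAlgClosure F) (algebraMap L (NormedAlgClosure F) x) = φ x
    rw [AlgHom.liftNormal_commutes]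
    rfl
  -- `g ∘ φ` and the permutation it induces
  let perm : BaseGaloisGroup hp → (L →ₐ[PadicBase F p hp] NormedAlgClosure F) ≃
      (L →ₐ[PadicBase F p hp] NormedAlgClosure F) := fun g =>
    { toFun := fun φ => (g : NormedAlgClosure F →ₐ[PadicBase F p hp] NormedAlgClosure F).comp φ
      invFun := fun φ => ((g⁻¹ : BaseGaloisGroup hp) : NormedAlgClosure F →ₐ[PadicBase F p hp] NormedAlgClosure F).comp φ
      left_inv := fun φ => by
        ext x
        change g⁻¹ (g (φ x)) = φ x
        rw [AlgEquiv.aut_inv, AlgEquiv.symm_apply_apply]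
      right_inv := fun φ => by
        ext x
        change g (g⁻¹ (φ x)) = φ x
        rw [AlgEquiv.aut_inv, AlgEquiv.apply_symm_apply] }
  have hperm : ∀ (g : BaseGaloisGroup hp) (φ : L →ₐ[PadicBase F p hp] NormedAlgClosure F) (x : L),
      perm g φ x = g (φ x) := fun _ _ _ => rfl
  -- the corrections `h_φ = s_{gφ}⁻¹ g s_φ` fix `L`, hence `f(h_φ) = 0`
  have hcorr : ∀ (g : BaseGaloisGroup hp) (φ : L →ₐ[PadicBase F p hp] NormedAlgClosure F),
      f ((s (perm g φ))⁻¹ * g * s φ) = 0 := by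
    intro g φ
    apply hvan
    rw [IntermediateField.mem_fixingSubgroup_iff]
    intro x hx
    change ((s (perm g φ))⁻¹ * g * s φ) • x = x
    rw [mul_smul, mul_smul, BaseGaloisGroup.smul_def, BaseGaloisGroup.smul_def, BaseGaloisGroup.smul_def,
      show x = ((⟨x, hx⟩ : L) : NormedAlgClosure F) from rfl, hs, AlgEquiv.aut_inv, AlgEquiv.symm_apply_eq,
      hs, hperm]
  -- `g • f(s_φ) = f(s_{gφ}) − f(g)`
  have hkey : ∀ (g : BaseGaloisGroup hp) (φ : L →ₐ[PadicBase F p hp] NormedAlgClosure F),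
      g • f (s φ) = f (s (perm g φ)) - f g := by
    intro g φ
    have hmul : g * s φ = s (perm g φ) * ((s (perm g φ))⁻¹ * g * s φ) := by group
    have h1 := hcoc g (s φ)
    rw [hmul, hcoc, hcorr, smul_zero, add_zero] at h1
    linear_combination -h1
  set d : ℕ := Fintype.card (L →ₐ[PadicBase F p hp] NormedAlgClosure F) with hd
  haveI : Nonempty (L →ₐ[PadicBase F p hp] NormedAlgClosure F) := ⟨L.val⟩
  have hd0 : (d : CompletedAlgClosure F) ≠ 0 := Nat.cast_ne_zero.mpr Fintype.card_ne_zero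
  refine ⟨-((d : CompletedAlgClosure F)⁻¹ * ∑ φ, f (s φ)), fun g => ?_⟩
  -- `g • Σ_φ f(s_φ) = Σ_φ f(s_{gφ}) − d f(g) = Σ_φ f(s_φ) − d f(g)`
  have hsum : g • (∑ φ, f (s φ)) = (∑ φ, f (s φ)) - d * f g := by
    rw [Finset.smul_sum, Finset.sum_congr rfl fun φ _ => hkey g φ, Finset.sum_sub_distrib,
      Equiv.sum_comp (perm g) (fun φ => f (s φ)), Finset.sum_const, Finset.card_univ, hd, nsmul_eq_mul]
  have hnat : g • ((d : CompletedAlgClosure F)⁻¹ * ∑ φ, f (s φ)) =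
      (d : CompletedAlgClosure F)⁻¹ * g • ∑ φ, f (s φ) := by
    rw [smul_mul', smul_inv'', smul_natCast hp]
  rw [smul_neg, hnat, hsum]
  field_simp
  ring

end FiniteLayer

end Literature.NumberTheory.PAdicHodge

end
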